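import Mathlib.Analysis.InnerProductSpace.Spectrum
import Mathlib.Analysis.Normed.Ring.Units
import Mathlib.Analysis.SpecificLimits.Basic
import Mathlib.MeasureTheory.Constructions.BorelSpace.ContinuousLinearMap
import Mathlib.MeasureTheory.Constructions.Polish.StronglyMeasurable
import HarnessLib

/-!
# Measurable gauge fixing modulo the kernels of nonnegative symmetric operators

Analysis/FunctionSpaces support file (all results proved; no definitions, no named facts).

Let `E` be a finite-dimensional real inner product space and `A : E →L[ℝ] E` symmetric with
`⟪A x, x⟫ ≥ 0`. For `ε > 0` the operator `ε + A` is invertible, and the resolvent applied to a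
vector of the range, `(ε + A)⁻¹ (A β)`, converges as `ε ↓ 0` to the component of `β` orthogonal to
`ker A` (in an orthonormal eigenbasis `A bᵢ = λᵢ bᵢ` it is `∑ λᵢ / (ε + λᵢ) ⟪bᵢ, β⟫ bᵢ`; Kato 1966,
I §5.3: the reduced resolvent and the eigenprojection for the eigenvalue `0`). This gives a
CANONICAL preimage of `A β` modulo `ker A`, of norm `≤ ‖β‖`, obtained from `A β` alone by a limit
of continuous operations. Consequently, for a MEASURABLE family `A(i)` of such operators and a
measurable `y(i)`, there is a measurable `g(i)` with `A(i) g(i) = A(i) β` and `‖g(i)‖ ≤ ‖β‖`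
whenever `y(i) = A(i) β` — a measurable gauge fixing modulo the kernels, used to replace a
non-measurable drift `β(τ)` by a measurable one in the Galilean gauge of bounded ancient mild
solutions of Navier–Stokes (crux `TypeIliouvilleL`, item stmt-NavierStokesRegularity-10661).

Main results:

* `measurable_ringInverse` — `Ring.inverse` is Borel measurable on a normed ring with summable
  geometric series (continuous on the open set of units, zero off it).
* `measurable_clm_apply` — `i ↦ T i (v i)` is measurable for measurable `T`, `v`.
* `isUnit_smul_one_add_of_inner_nonneg` — `ε • 1 + A` is a unit for `ε > 0`, `⟪A x, x⟫ ≥ 0`.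
* `exists_tendsto_ringInverse_apply_of_isSymmetric_nonneg` — **resolvent selection of a preimage
  modulo the kernel**: `(1/(n+1) + A)⁻¹ (A β) → β'` with `A β' = A β`, `‖β'‖ ≤ ‖β‖`.
* `exists_measurable_kernel_gauge` — **measurable gauge fixing** modulo the kernels of a measurable
  family of nonnegative symmetric operators.

## References

* T. Kato, *Perturbation Theory for Linear Operators* (Springer 1966), Ch. I §5.3 (eigenprojections,
  reduced resolvent; `(ζ - A)⁻¹` near an eigenvalue). [Kato1966]
-/

noncomputable section

open MeasureTheory Set Function Filter Topology TopologicalSpace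
open scoped RealInnerProductSpace

namespace Literature.Analysis.FunctionSpaces

/-! ### Measurability of `Ring.inverse` and of evaluation -/

section RingInverse

variable {R : Type*} [NormedRing R] [HasSummableGeomSeries R] [MeasurableSpace R] [BorelSpace R]

/-- `Ring.inverse` is Borel measurable on a normed ring with summable geometric series (e.g. a
complete normed ring): it is continuous on the open set of units (`NormedRing.inverse_continuousAt`)
and vanishes identically off it. [folklore] -/
theorem measurable_ringInverse : Measurable (Ring.inverse : R → R) := by
  classical
  have h : Measurable ({x : R | IsUnit x}.piecewise Ring.inverse fun _ => (0 : R)) :=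
    ContinuousOn.measurable_piecewise
      (fun x hx => by
        obtain ⟨u, rfl⟩ := hx
        exact (NormedRing.inverse_continuousAt u).continuousWithinAt)
      continuousOn_const Units.isOpen.measurableSet
  convert h using 1
  ext x
  by_cases hx : IsUnit x
  · exact (Set.piecewise_eq_of_mem {x : R | IsUnit x} _ _ hx).symm
  · rw [Set.piecewise_eq_of_notMem {x : R | IsUnit x} _ _ hx]
    exact Ring.inverse_non_unit _ hx

end RingInverse

section Eval

variable {𝕜 : Type*} [NontriviallyNormedField 𝕜] {F G : Type*} [NormedAddCommGroup F]
  [NormedSpace 𝕜 F] [NormedAddCommGroup G] [NormedSpace 𝕜 G]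

/-- Evaluation `a ↦ T a (v a)` of a measurable family of continuous linear maps at a measurable
family of vectors is measurable (evaluation is a continuous bilinear map; one factor is second
countable, so the Borel σ-algebra of the product is the product of the Borel σ-algebras).
[folklore] -/
theorem measurable_clm_apply {α : Type*} [MeasurableSpace α] [MeasurableSpace F] [BorelSpace F]
    [MeasurableSpace G] [BorelSpace G] [SecondCountableTopologyEither (F →L[𝕜] G) F]
    {T : α → F →L[𝕜] G} (hT : Measurable T) {v : α → F} (hv : Measurable v) :
    Measurable fun a => T a (v a) :=
  (isBoundedBilinearMap_apply (𝕜 := 𝕜) (E := F) (F := G)).continuous.measurable.comp (hT.prodMk hv)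

end Eval

/-! ### The resolvent of a nonnegative symmetric operator at `-ε` -/

variable {E : Type*} [NormedAddCommGroup E] [InnerProductSpace ℝ E] [FiniteDimensional ℝ E]

/-- For `ε > 0` and `A` with `⟪A x, x⟫ ≥ 0`, the operator `ε • 1 + A` is invertible in the ring
`E →L[ℝ] E` (it is bounded below, `⟪(ε + A) x, x⟫ ≥ ε ‖x‖²`, hence injective, hence bijective in
finite dimension). [folklore] -/
theorem isUnit_smul_one_add_of_inner_nonneg (A : E →L[ℝ] E) (hpos : ∀ x, 0 ≤ ⟪A x, x⟫) {ε : ℝ}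
    (hε : 0 < ε) : IsUnit (ε • (1 : E →L[ℝ] E) + A) := by
  set R := ε • (1 : E →L[ℝ] E) + A with hR
  have hinj : Function.Injective R := by
    refine (injective_iff_map_eq_zero R).2 fun x hx => ?_
    have h1 : ⟪R x, x⟫ = ε * ‖x‖ ^ 2 + ⟪A x, x⟫ := by
      simp only [hR, _root_.add_apply, _root_.smul_apply, one_apply_eq_self, inner_add_left,
        real_inner_smul_left, real_inner_self_eq_norm_sq]
    rw [hx, inner_zero_left] at h1
    have h2 : ‖x‖ ^ 2 = 0 := by nlinarith [hpos x, sq_nonneg ‖x‖]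
    exact norm_eq_zero.1 (pow_eq_zero_iff two_ne_zero |>.1 h2)
  let e : E ≃L[ℝ] E := (LinearEquiv.ofInjectiveEndo (R : E →ₗ[ℝ] E) hinj).toContinuousLinearEquiv
  have he : (e : E →L[ℝ] E) = R := by
    ext x
    rfl
  exact he ▸ ⟨e.toUnit, rfl⟩

/-- **Resolvent selection of a preimage modulo the kernel.** For a symmetric `A : E →L[ℝ] E` with
`⟪A x, x⟫ ≥ 0` on a finite-dimensional real inner product space and any `β`, the vectors
`(1/(n+1) + A)⁻¹ (A β)` converge, as `n → ∞`, to a vector `β'` with `A β' = A β` and `‖β'‖ ≤ ‖β‖`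
(namely the component of `β` orthogonal to `ker A`: in an orthonormal eigenbasis `A bᵢ = λᵢ bᵢ`,
`λᵢ ≥ 0`, one has `(ε + A)⁻¹ (A β) = ∑ᵢ λᵢ/(ε + λᵢ) ⟪bᵢ, β⟫ bᵢ → ∑_{λᵢ ≠ 0} ⟪bᵢ, β⟫ bᵢ`).
Kato 1966, I §5.3. [folklore] -/
theorem exists_tendsto_ringInverse_apply_of_isSymmetric_nonneg
    (A : E →L[ℝ] E) (hA : (A : E →ₗ[ℝ] E).IsSymmetric) (hpos : ∀ x, 0 ≤ ⟪A x, x⟫) (β : E) :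
    ∃ β' : E,
      Tendsto (fun n : ℕ => Ring.inverse ((((n : ℝ) + 1)⁻¹) • (1 : E →L[ℝ] E) + A) (A β)) atTop
        (𝓝 β') ∧
      A β' = A β ∧ ‖β'‖ ≤ ‖β‖ := by
  classical
  -- spectral data: an orthonormal eigenbasis `b` with eigenvalues `ev ≥ 0`
  set b : OrthonormalBasis (Fin (Module.finrank ℝ E)) ℝ E := hA.eigenvectorBasis rfl with hb
  set ev : Fin (Module.finrank ℝ E) → ℝ := hA.eigenvalues rfl with hev
  have hAb : ∀ i, A (b i) = ev i • b i := fun i => by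
    simpa [-LinearMap.IsSymmetric.apply_eigenvectorBasis] using hA.apply_eigenvectorBasis rfl i
  have hev0 : ∀ i, 0 ≤ ev i := fun i => by
    have h := hpos (b i)
    rw [hAb, real_inner_smul_left, real_inner_self_eq_norm_sq, b.orthonormal.1 i] at h
    simpa using h
  -- the limit coefficients
  set c : Fin (Module.finrank ℝ E) → ℝ := fun i => if ev i = 0 then 0 else ⟪b i, β⟫ with hc
  have hAβ : A β = ∑ i, (⟪b i, β⟫ * ev i) • b i := by
    conv_lhs => rw [← b.sum_repr' β]
    simp only [map_sum, map_smul, hAb, smul_smul]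
  -- the resolvent applied to `A β`, in the eigenbasis
  have key : ∀ ε : ℝ, 0 < ε →
      Ring.inverse (ε • (1 : E →L[ℝ] E) + A) (A β) = ∑ i, (ev i / (ε + ev i) * ⟪b i, β⟫) • b i := by
    intro ε hε
    have hR : (ε • (1 : E →L[ℝ] E) + A) (∑ i, (ev i / (ε + ev i) * ⟪b i, β⟫) • b i) = A β := by
      rw [hAβ, map_sum]
      refine Finset.sum_congr rfl fun i _ => ?_
      have hεi : ε + ev i ≠ 0 := (add_pos_of_pos_of_nonneg hε (hev0 i)).ne'
      rw [map_smul, _root_.add_apply, _root_.smul_apply, one_apply_eq_self, hAb, ← add_smul,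
        smul_smul]
      congr 1
      rw [div_mul_eq_mul_div, div_mul_cancel₀ _ hεi, mul_comm]
    rw [← hR, ← mul_apply_eq_comp,
      Ring.inverse_mul_cancel _ (isUnit_smul_one_add_of_inner_nonneg A hpos hε), one_apply_eq_self]
  refine ⟨∑ i, c i • b i, ?_, ?_, ?_⟩
  · -- convergence, coefficientwise
    have hseq : (fun n : ℕ => Ring.inverse ((((n : ℝ) + 1)⁻¹) • (1 : E →L[ℝ] E) + A) (A β)) =
        fun n : ℕ => ∑ i, (ev i / (((n : ℝ) + 1)⁻¹ + ev i) * ⟪b i, β⟫) • b i := by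
      funext n
      exact key _ (by positivity)
    rw [hseq]
    refine tendsto_finsetSum _ fun i _ => Tendsto.smul_const ?_ (b i)
    have h0 : Tendsto (fun n : ℕ => ((n : ℝ) + 1)⁻¹) atTop (𝓝 0) := by
      simpa only [one_div] using tendsto_one_div_add_atTop_nhds_zero_nat (𝕜 := ℝ)
    by_cases hi : ev i = 0
    · simp only [hi, zero_div, zero_mul, hc, if_pos]
      exact tendsto_const_nhds
    · have h1 : Tendsto (fun n : ℕ => ev i / (((n : ℝ) + 1)⁻¹ + ev i) * ⟪b i, β⟫) atTop
          (𝓝 (ev i / (0 + ev i) * ⟪b i, β⟫)) :=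
        (tendsto_const_nhds.div (h0.add tendsto_const_nhds) (by simpa using hi)).mul_const _
      simp only [hc, if_neg hi]
      simpa [hi] using h1
  · -- `A β' = A β`
    rw [hAβ, map_sum]
    refine Finset.sum_congr rfl fun i _ => ?_
    rw [map_smul, hAb, smul_smul]
    congr 1
    simp only [hc]
    split_ifs with hi <;> simp [hi]
  · -- `‖β'‖ ≤ ‖β‖` (Parseval)
    have h1 : ‖∑ i, c i • b i‖ ^ 2 = ∑ i, c i ^ 2 := by
      rw [← b.sum_sq_inner_right]
      refine Finset.sum_congr rfl fun i _ => ?_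
      rw [b.orthonormal.inner_right_fintype]
    have h2 : ∑ i, c i ^ 2 ≤ ‖β‖ ^ 2 := by
      rw [← b.sum_sq_inner_right β]
      refine Finset.sum_le_sum fun i _ => ?_
      simp only [hc]
      split_ifs
      · rw [zero_pow two_ne_zero]
        exact sq_nonneg _
      · exact le_rfl
    rw [← h1] at h2
    exact (pow_le_pow_iff_left₀ (norm_nonneg _) (norm_nonneg _) two_ne_zero).1 h2

/-- **Measurable gauge fixing modulo the kernels.** Let `A : ι → E →L[ℝ] E` be a measurable
family of symmetric operators with `⟪A i x, x⟫ ≥ 0` on a finite-dimensional real inner product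
space, and `y : ι → E` measurable. Then there is a MEASURABLE `g : ι → E` such that, at every
index `i` where `y i = A i β` lies in the range, `g i` is a preimage of `y i` of norm `≤ ‖β‖`
(for every such `β`): `A i (g i) = A i β` and `‖g i‖ ≤ ‖β‖`. Construction:
`g i := lim_n (1/(n+1) + A i)⁻¹ (y i)` (`exists_tendsto_ringInverse_apply_of_isSymmetric_nonneg`;
the pointwise `limUnder` of a sequence of measurable maps is measurable). [folklore] -/
theorem exists_measurable_kernel_gauge {ι : Type*} [MeasurableSpace ι] [MeasurableSpace E]
    [BorelSpace E] {A : ι → E →L[ℝ] E} (hA : Measurable A)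
    (hsymm : ∀ i, (A i : E →ₗ[ℝ] E).IsSymmetric) (hpos : ∀ i x, 0 ≤ ⟪A i x, x⟫)
    {y : ι → E} (hy : Measurable y) :
    ∃ g : ι → E, Measurable g ∧ ∀ i (β : E), y i = A i β → A i (g i) = A i β ∧ ‖g i‖ ≤ ‖β‖ := by
  -- the approximants `i ↦ (1/(n+1) + A i)⁻¹ (y i)` are measurable
  have hFm : ∀ n : ℕ, Measurable fun i =>
      Ring.inverse ((((n : ℝ) + 1)⁻¹) • (1 : E →L[ℝ] E) + A i) (y i) := fun n =>
    measurable_clm_apply (measurable_ringInverse.comp (hA.const_add _)) hy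
  refine ⟨fun i => limUnder atTop fun n : ℕ =>
      Ring.inverse ((((n : ℝ) + 1)⁻¹) • (1 : E →L[ℝ] E) + A i) (y i), ?_, fun i β hyi => ?_⟩
  · exact (MeasureTheory.StronglyMeasurable.limUnder fun n => (hFm n).stronglyMeasurable).measurable
  · obtain ⟨β', hT, hAβ', hnorm⟩ :=
      exists_tendsto_ringInverse_apply_of_isSymmetric_nonneg (A i) (hsymm i) (hpos i) β
    have hlim : (limUnder atTop fun n : ℕ =>
        Ring.inverse ((((n : ℝ) + 1)⁻¹) • (1 : E →L[ℝ] E) + A i) (y i)) = β' := by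
      rw [hyi]
      exact hT.limUnder_eq
    simp only [hlim]
    exact ⟨hAβ', hnorm⟩

end Literature.Analysis.FunctionSpaces
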